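import Literature.NumberTheory.PAdicHodge.TateTwistInvariants
import Mathlib.Algebra.Polynomial.Laurent
import Mathlib.Algebra.MonoidAlgebra.NoZeroDivisors
import HarnessLib

/-!
# The Hodge–Tate period ring `B_HT(F) = ℂ_F[t, t⁻¹] = ⊕_{i ∈ ℤ} ℂ_F(i)`

Let `F` be a non-archimedean local field of characteristic `0` and residue characteristic `p`
(`hp : valuation F p < 1`), `ℂ_F = CompletedAlgClosure F` with its continuous `Γ_F`-action
(`CompletedAlgClosure`), `χ_F : Γ_F → ℤ_pˣ` the cyclotomic character. Fontaine's **Hodge–Tate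
period ring** (Fontaine 1994, Exp. II §1.5 / Exp. III §1.5: `B_HT = gr B_dR = ⊕_i ℂ(i) = ℂ[t, 1/t]`;
Fontaine–Ouyang §5.1; Brinon–Conrad §2.4) is the ring of Laurent polynomials

  `B_HT(F) := ℂ_F[T; T⁻¹]`  (`HT hp`, a type synonym of Mathlib's `LaurentPolynomial ℂ_F`)

with `Γ_F` acting SEMILINEARLY: `σ(c Tⁱ) = σ(c) χ_F(σ)ⁱ Tⁱ` (so `T` is Fontaine's `t`, spanning
`ℚ_p(1)`), graded/filtered by the degree in `T` (`Fil^i B_HT = ⊕_{n ≥ i} ℂ_F Tⁿ`).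

This file constructs the ring with its action and filtration:
* `HT hp` (a commutative domain, an `ℂ_F`- and `F`-algebra), `HT.twist hp σ = χ_F(σ) ∈ ℂ_F`
  (through `ℤ_p ⊆ ℚ_p → F → ℂ_F`, canonical `LocalField.padicRingHom`);
* the action `HT.galHT : Γ_F →* (HT ≃+* HT)` (Mathlib `LaurentPolynomial.eval₂` at the unit
  `χ(σ) T`), `MulSemiringAction Γ_F (HT hp)`, the coefficient formula
  `(σ • f)_n = σ(f_n) χ(σ)ⁿ` (`HT.coeff_smul`), `SMulCommClass Γ_F F (HT hp)`;
* the filtration `HT.fil i` by `F`-submodules: decreasing, multiplicative, `Γ_F`-stable,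
  exhaustive and separated.

Fontaine's regularity axioms (`B_HT^{Γ_F} = F` from Ax–Sen–Tate and Tate's theorem,
`(Frac B_HT)^{Γ_F} = F`, "a `Γ_F`-stable line is spanned by a unit") and the resulting
`PeriodRingData` are in `HodgeTatePeriodRingData`.

## References

* J.-M. Fontaine, *Le corps des périodes p-adiques*, Astérisque 223 (1994), Exp. II §1.5.5
  (`B_HT`). [FontaineAsterisque223III]
* J.-M. Fontaine, Y. Ouyang, *Theory of p-adic Galois representations*, §5.1 (Hodge–Tate
  representations, `B_HT = ⊕ C(i)`). [FontaineOuyang2022]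
* J. Tate, *p-divisible groups* (1967), §3.3. [Tate1967]
-/

noncomputable section

open ValuativeRel Field UniformSpace LaurentPolynomial

open scoped Pointwise

namespace Literature.NumberTheory.PAdicHodge

open Literature.NumberTheory.GaloisRepresentations
open Literature.NumberTheory.GaloisRepresentations.IsNonarchimedeanLocalField

variable {F : Type} [Field F] [ValuativeRel F] [TopologicalSpace F] [IsNonarchimedeanLocalField F]
  {p : ℕ}

/-- **The Hodge–Tate period ring `B_HT(F) = ℂ_F[T; T⁻¹]`**: a type synonym for the Laurent
polynomials over `ℂ_F` (the parameter `hp`, the residue characteristic hypothesis, fixes the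
cyclotomic twist of the `Γ_F`-action declared below). [cite: FontaineAsterisque223III, Exp. II §1.5.5] -/
@[nolint unusedArguments]
def HT (_hp : valuation F p < 1) : Type := LaurentPolynomial (CompletedAlgClosure F)

namespace HT

variable (hp : valuation F p < 1)

/-- `B_HT` is a commutative ring (Mathlib's structure on Laurent polynomials). [folklore] -/
instance instCommRing : CommRing (HT hp) := inferInstanceAs (CommRing (LaurentPolynomial (CompletedAlgClosure F)))

/-- `B_HT` is a domain. [folklore] -/
instance instIsDomain : IsDomain (HT hp) := inferInstanceAs (IsDomain (LaurentPolynomial (CompletedAlgClosure F)))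

/-- `B_HT` is a `ℂ_F`-algebra. [folklore] -/
instance instAlgebraC : Algebra (CompletedAlgClosure F) (HT hp) :=
  inferInstanceAs (Algebra (CompletedAlgClosure F) (LaurentPolynomial (CompletedAlgClosure F)))

/-- `B_HT` is an `F`-algebra (`F → ℂ_F → B_HT`). [folklore] -/
instance instAlgebra : Algebra F (HT hp) :=
  inferInstanceAs (Algebra F (LaurentPolynomial (CompletedAlgClosure F)))

/-- `F → ℂ_F → B_HT` is a scalar tower. [folklore] -/
instance instIsScalarTower : IsScalarTower F (CompletedAlgClosure F) (HT hp) :=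
  inferInstanceAs (IsScalarTower F (CompletedAlgClosure F) (LaurentPolynomial (CompletedAlgClosure F)))

/-- The identification `HT hp = ℂ_F[T;T⁻¹]` (identity), as a ring isomorphism. [folklore] -/
def toLaurent : HT hp ≃+* LaurentPolynomial (CompletedAlgClosure F) := RingEquiv.refl _

/-- The `n`-th coefficient of an element of `B_HT`. [folklore] -/
def coeff (f : HT hp) (n : ℤ) : CompletedAlgClosure F := (toLaurent hp f).coeff n

/-- Two elements of `B_HT` with the same coefficients are equal. [folklore] -/
theorem ext {f g : HT hp} (h : ∀ n, coeff hp f n = coeff hp g n) : f = g :=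
  LaurentPolynomial.ext h

/-- The monomial `c Tⁿ ∈ B_HT`. [folklore] -/
def mono (c : CompletedAlgClosure F) (n : ℤ) : HT hp :=
  (toLaurent hp).symm (LaurentPolynomial.C c * LaurentPolynomial.T n)

/-- `toLaurent (mono c n) = C c * T n`. [folklore] -/
theorem toLaurent_mono (c : CompletedAlgClosure F) (n : ℤ) :
    toLaurent hp (mono hp c n) = LaurentPolynomial.C c * LaurentPolynomial.T n := rfl

/-- `mono c n` is the Finsupp single. [folklore] -/
theorem mono_eq_single (c : CompletedAlgClosure F) (n : ℤ) :
    toLaurent hp (mono hp c n) = AddMonoidAlgebra.single n c := by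
  rw [toLaurent_mono, ← LaurentPolynomial.single_eq_C_mul_T]

/-- Coefficients of a monomial. [folklore] -/
theorem coeff_mono (c : CompletedAlgClosure F) (n m : ℤ) :
    coeff hp (mono hp c n) m = if n = m then c else 0 := by
  change (toLaurent hp (mono hp c n)).coeff m = _
  rw [mono_eq_single, AddMonoidAlgebra.coeff_single, Finsupp.single_apply]

/-- Coefficients are additive. [folklore] -/
theorem coeff_add (f g : HT hp) (n : ℤ) : coeff hp (f + g) n = coeff hp f n + coeff hp g n := rfl

/-- Coefficients of `0`. [folklore] -/
theorem coeff_zero (n : ℤ) : coeff hp 0 n = 0 := rfl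

/-- Coefficients of a negative. [folklore] -/
theorem coeff_neg (f : HT hp) (n : ℤ) : coeff hp (-f) n = -coeff hp f n := rfl

/-- Coefficients of a difference. [folklore] -/
theorem coeff_sub (f g : HT hp) (n : ℤ) : coeff hp (f - g) n = coeff hp f n - coeff hp g n := rfl

/-- `mono` is additive in the coefficient. [folklore] -/
theorem mono_add (c d : CompletedAlgClosure F) (n : ℤ) : mono hp (c + d) n = mono hp c n + mono hp d n := by
  apply (toLaurent hp).injective
  rw [map_add, mono_eq_single, mono_eq_single, mono_eq_single, AddMonoidAlgebra.single_add]

/-- `0 · Tⁿ = 0`. [folklore] -/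
theorem mono_zero (n : ℤ) : mono hp 0 n = 0 := by
  apply (toLaurent hp).injective
  rw [mono_eq_single, AddMonoidAlgebra.single_zero, map_zero]

/-- `c Tᵐ · d Tⁿ = c d T^{m+n}`. [folklore] -/
theorem mono_mul_mono (c d : CompletedAlgClosure F) (m n : ℤ) :
    mono hp c m * mono hp d n = mono hp (c * d) (m + n) := by
  apply (toLaurent hp).injective
  rw [map_mul, mono_eq_single, mono_eq_single, mono_eq_single, AddMonoidAlgebra.single_mul_single]

/-- `1 = 1 · T⁰`. [folklore] -/
theorem mono_one_zero : mono hp 1 0 = 1 := by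
  apply (toLaurent hp).injective
  rw [mono_eq_single, map_one]; rfl

/-- The algebra map `ℂ_F → B_HT` is `c ↦ c T⁰`. [folklore] -/
theorem algebraMap_C_eq (c : CompletedAlgClosure F) : algebraMap (CompletedAlgClosure F) (HT hp) c = mono hp c 0 := by
  apply (toLaurent hp).injective
  rw [toLaurent_mono, LaurentPolynomial.T_zero, mul_one]
  exact (LaurentPolynomial.C_eq_algebraMap c).symm

/-- The algebra map `F → B_HT` is `a ↦ a T⁰`. [folklore] -/
theorem algebraMap_eq (a : F) :
    algebraMap F (HT hp) a = mono hp (algebraMap F (CompletedAlgClosure F) a) 0 := by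
  rw [IsScalarTower.algebraMap_apply F (CompletedAlgClosure F) (HT hp), algebraMap_C_eq]

/-- **Induction on `B_HT`**: additive closure of the monomials. [folklore] -/
theorem induction_on {P : HT hp → Prop} (f : HT hp) (zero : P 0) (add : ∀ f g, P f → P g → P (f + g))
    (mono' : ∀ c n, P (mono hp c n)) : P f := by
  change P ((toLaurent hp).symm (toLaurent hp f))
  refine AddMonoidAlgebra.induction_linear (p := fun x => P ((toLaurent hp).symm x)) (toLaurent hp f)
    zero (fun x y hx hy => ?_) (fun n c => ?_)
  · exact add _ _ hx hy
  · rw [← mono_eq_single hp]; exact mono' c n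

/-- Every element is the (finite) sum of its monomials. [folklore] -/
theorem sum_mono_coeff (f : HT hp) :
    (toLaurent hp f).coeff.support.sum (fun n => mono hp (coeff hp f n) n) = f := by
  apply (toLaurent hp).injective
  rw [map_sum]
  simp only [mono_eq_single]
  exact AddMonoidAlgebra.sum_coeff_single (toLaurent hp f)

/-- Coefficients of `c T⁰ · f`. [folklore] -/
theorem coeff_mono_zero_mul (c : CompletedAlgClosure F) (f : HT hp) (n : ℤ) :
    coeff hp (mono hp c 0 * f) n = c * coeff hp f n := by
  induction f using induction_on hp with
  | zero => rw [mul_zero, coeff_zero, mul_zero]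
  | add f g hf hg => rw [mul_add, coeff_add, coeff_add, hf, hg, mul_add]
  | mono' d m =>
    rw [mono_mul_mono, zero_add, coeff_mono, coeff_mono]
    split_ifs <;> simp

/-- Coefficients of `a • f`, `a ∈ F`. [folklore] -/
theorem coeff_base_smul (a : F) (f : HT hp) (n : ℤ) :
    coeff hp (a • f) n = algebraMap F (CompletedAlgClosure F) a * coeff hp f n := by
  rw [Algebra.smul_def, algebraMap_eq, coeff_mono_zero_mul]

/-- The support (set of exponents with non-zero coefficient) of `f`. [folklore] -/
def support (f : HT hp) : Finset ℤ := (toLaurent hp f).coeff.support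

/-- `n ∈ support f ↔ coeff f n ≠ 0`. [folklore] -/
theorem mem_support_iff {f : HT hp} {n : ℤ} : n ∈ support hp f ↔ coeff hp f n ≠ 0 :=
  Finsupp.mem_support_iff

/-- **Support of a product** `⊆ support f + support g`. [folklore] -/
theorem support_mul_subset (f g : HT hp) : support hp (f * g) ⊆ support hp f + support hp g :=
  AddMonoidAlgebra.support_coeff_mul_subset (toLaurent hp f) (toLaurent hp g)

/-- The unit `c Tⁿ` of `B_HT` for a unit `c`. [folklore] -/
def monoUnit (c : (CompletedAlgClosure F)ˣ) (n : ℤ) : (HT hp)ˣ where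
  val := mono hp c n
  inv := mono hp (c⁻¹ : (CompletedAlgClosure F)ˣ) (-n)
  val_inv := by rw [mono_mul_mono, Units.mul_inv, add_neg_cancel, mono_one_zero]
  inv_val := by rw [mono_mul_mono, Units.inv_mul, neg_add_cancel, mono_one_zero]

/-- `monoUnit c 1 ^ n = monoUnit (c^n) n`. [folklore] -/
theorem monoUnit_one_zpow (c : (CompletedAlgClosure F)ˣ) (n : ℤ) :
    monoUnit hp c 1 ^ n = monoUnit hp (c ^ n) n := by
  induction n using Int.induction_on with
  | zero => ext; change (1 : HT hp) = mono hp ((c ^ (0 : ℤ) : (CompletedAlgClosure F)ˣ) : CompletedAlgClosure F) 0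
            rw [zpow_zero, Units.val_one, mono_one_zero]
  | succ n ih =>
    rw [zpow_add_one, ih]; ext
    change mono hp ((c ^ (n : ℤ) : (CompletedAlgClosure F)ˣ) : CompletedAlgClosure F) n * mono hp c 1 = mono hp ((c ^ ((n : ℤ) + 1) : (CompletedAlgClosure F)ˣ) : CompletedAlgClosure F) (n + 1)
    rw [mono_mul_mono, zpow_add_one, Units.val_mul]
  | pred n ih =>
    rw [zpow_sub_one, ih]; ext
    change mono hp ((c ^ (-(n : ℤ)) : (CompletedAlgClosure F)ˣ) : CompletedAlgClosure F) (-n) *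
      mono hp ((c⁻¹ : (CompletedAlgClosure F)ˣ) : CompletedAlgClosure F) (-1) =
      mono hp ((c ^ (-(n : ℤ) - 1) : (CompletedAlgClosure F)ˣ) : CompletedAlgClosure F) (-n - 1)
    rw [mono_mul_mono, zpow_sub_one, Units.val_mul, sub_eq_add_neg]

/-- Ring homomorphisms out of `B_HT` agreeing on monomials are equal. [folklore] -/
theorem ringHom_ext_mono {S : Type*} [Semiring S] {f g : HT hp →+* S}
    (h : ∀ c n, f (mono hp c n) = g (mono hp c n)) : f = g := by
  refine RingHom.ext fun x => ?_
  induction x using induction_on hp with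
  | zero => rw [map_zero, map_zero]
  | add x y hx hy => rw [map_add, map_add, hx, hy]
  | mono' c n => exact h c n

/-! ### The filtration `Fil^i B_HT = ⊕_{n ≥ i} ℂ_F Tⁿ` -/

/-- **`Fil^i B_HT`**: Laurent polynomials with no terms of degree `< i`, an `F`-submodule.
[cite: FontaineAsterisque223III, Exp. II §1.5.5] -/
def fil (i : ℤ) : Submodule F (HT hp) where
  carrier := {f | ∀ n, n < i → coeff hp f n = 0}
  zero_mem' := fun n _ => coeff_zero hp n
  add_mem' := by
    intro f g hf hg n hn
    rw [coeff_add, hf n hn, hg n hn, add_zero]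
  smul_mem' := by
    intro a f hf n hn
    change coeff hp (a • f) n = 0
    rw [coeff_base_smul, hf n hn, mul_zero]

/-- Membership in `Fil^i`. [folklore] -/
theorem mem_fil_iff {i : ℤ} {f : HT hp} : f ∈ fil hp i ↔ ∀ n, n < i → coeff hp f n = 0 := Iff.rfl

/-- Membership in `Fil^i` through the support. [folklore] -/
theorem mem_fil_iff_support {i : ℤ} {f : HT hp} : f ∈ fil hp i ↔ ∀ n ∈ support hp f, i ≤ n := by
  rw [mem_fil_iff]
  constructor
  · intro h n hn
    by_contra hlt
    exact (mem_support_iff hp).mp hn (h n (not_le.mp hlt))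
  · intro h n hn
    by_contra hne
    exact (not_le.mpr hn) (h n ((mem_support_iff hp).mpr hne))

/-- The filtration is decreasing. [folklore] -/
theorem fil_antitone : Antitone (fil hp) := by
  intro i j hij f hf n hn
  exact hf n (lt_of_lt_of_le hn hij)

/-- The filtration is multiplicative. [folklore] -/
theorem mul_mem_fil {i j : ℤ} {f g : HT hp} (hf : f ∈ fil hp i) (hg : g ∈ fil hp j) :
    f * g ∈ fil hp (i + j) := by
  rw [mem_fil_iff_support] at hf hg ⊢
  intro n hn
  obtain ⟨a, ha, b, hb, rfl⟩ := Finset.mem_add.mp (support_mul_subset hp f g hn)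
  exact add_le_add (hf a ha) (hg b hb)

/-- `1 ∈ Fil^0`. [folklore] -/
theorem one_mem_fil_zero : (1 : HT hp) ∈ fil hp 0 := by
  intro n hn
  rw [← mono_one_zero, coeff_mono, if_neg (by omega)]

/-- The filtration is exhaustive. [folklore] -/
theorem iSup_fil : ⨆ i, fil hp i = ⊤ := by
  refine eq_top_iff.mpr fun f _ => ?_
  obtain ⟨i, hi⟩ := (support hp f).bddBelow
  exact Submodule.mem_iSup_of_mem i ((mem_fil_iff_support hp).mpr fun n hn => hi hn)

/-- The filtration is separated. [folklore] -/
theorem iInf_fil : ⨅ i, fil hp i = ⊥ := by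
  refine eq_bot_iff.mpr fun f hf => ?_
  rw [Submodule.mem_iInf] at hf
  rw [Submodule.mem_bot]
  exact ext hp fun n => by rw [coeff_zero]; exact hf (n + 1) n (lt_add_one n)

/-! ### The cyclotomic twist and the `Γ_F`-action -/

variable [CharZero F] [Fact p.Prime]

/-- **`χ_F(σ) ∈ ℂ_F`**: the cyclotomic character pushed along `ℤ_p ⊆ ℚ_p → F → ℂ_F` (canonical
`LocalField.padicRingHom`), as a monoid homomorphism `Γ_F → ℂ_F`. [cite: Tate1967, §3.3] -/
def twistHom : absoluteGaloisGroup F →* CompletedAlgClosure F :=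
  (algebraMap F (CompletedAlgClosure F)).toMonoidHom.comp
    ((LocalField.padicRingHom F p hp).toMonoidHom.comp
      ((PadicInt.Coe.ringHom (p := p)).toMonoidHom.comp
        ((Units.coeHom ℤ_[p]).comp (GaloisRep.cyclotomicCharacter F p).toMonoidHom)))

/-- `χ_F(σ) ∈ ℂ_F`. [cite: Tate1967, §3.3] -/
def twist (σ : absoluteGaloisGroup F) : CompletedAlgClosure F := twistHom hp σ

/-- Unfolding of `twist`. [folklore] -/
theorem twist_def (σ : absoluteGaloisGroup F) :
    twist hp σ = algebraMap F (CompletedAlgClosure F) (LocalField.padicRingHom F p hp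
      (((GaloisRep.cyclotomicCharacter F p σ : ℤ_[p]ˣ) : ℤ_[p]) : ℚ_[p])) := rfl

/-- `twist` is multiplicative. [folklore] -/
theorem twist_mul (σ τ : absoluteGaloisGroup F) : twist hp (σ * τ) = twist hp σ * twist hp τ :=
  map_mul (twistHom hp) σ τ

/-- `twist 1 = 1`. [folklore] -/
theorem twist_one : twist hp 1 = 1 := map_one (twistHom hp)

/-- `χ_F(σ) ≠ 0` in `ℂ_F` (a unit). [folklore] -/
theorem twist_ne_zero (σ : absoluteGaloisGroup F) : twist hp σ ≠ 0 := by
  rw [twist_def, map_ne_zero, map_ne_zero]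
  exact (Units.isUnit _).map PadicInt.Coe.ringHom |>.ne_zero

/-- `twist σ⁻¹ = (twist σ)⁻¹`. [folklore] -/
theorem twist_inv (σ : absoluteGaloisGroup F) : twist hp σ⁻¹ = (twist hp σ)⁻¹ := by
  have h : twist hp σ⁻¹ * twist hp σ = 1 := by rw [← twist_mul, inv_mul_cancel, twist_one]
  exact eq_inv_of_mul_eq_one_left h

/-- `Γ_F` fixes `χ_F(σ) ∈ ℂ_F` (it lies in `F`). [folklore] -/
theorem smul_twist (τ σ : absoluteGaloisGroup F) : τ • twist hp σ = twist hp σ := by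
  rw [twist_def, CompletedAlgClosure.smul_algebraMap]

/-- The unit `χ_F(σ)` of `ℂ_F`. [folklore] -/
def twistU (σ : absoluteGaloisGroup F) : (CompletedAlgClosure F)ˣ :=
  Units.mk0 (twist hp σ) (twist_ne_zero hp σ)

/-- **The action of `σ ∈ Γ_F` on `B_HT` as a ring endomorphism**: `c Tⁿ ↦ σ(c) χ(σ)ⁿ Tⁿ`
(Mathlib `LaurentPolynomial.eval₂` at the unit `χ(σ) T`). [cite: FontaineAsterisque223III, Exp. II §1.5.5] -/
def galHTHom (σ : absoluteGaloisGroup F) : HT hp →+* HT hp :=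
  (LaurentPolynomial.eval₂ ((algebraMap (CompletedAlgClosure F) (HT hp)).comp
      (CompletedAlgClosure.galRingHom σ)) (monoUnit hp (twistU hp σ) 1)).comp
    (toLaurent hp).toRingHom

/-- `σ(c Tⁿ) = σ(c) χ(σ)ⁿ Tⁿ`. [cite: FontaineAsterisque223III, Exp. II §1.5.5] -/
theorem galHTHom_mono (σ : absoluteGaloisGroup F) (c : CompletedAlgClosure F) (n : ℤ) :
    galHTHom hp σ (mono hp c n) = mono hp (σ • c * twist hp σ ^ n) n := by
  change LaurentPolynomial.eval₂ _ _ (toLaurent hp (mono hp c n)) = _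
  rw [toLaurent_mono, LaurentPolynomial.eval₂_C_mul_T, monoUnit_one_zpow, RingHom.comp_apply,
    algebraMap_C_eq]
  change mono hp (σ • c) 0 * mono hp ((twistU hp σ ^ n : (CompletedAlgClosure F)ˣ) : CompletedAlgClosure F) n = _
  rw [mono_mul_mono, zero_add, Units.val_zpow_eq_zpow_val]
  rfl

/-- `galHTHom 1 = id`. [folklore] -/
theorem galHTHom_one : galHTHom hp 1 = RingHom.id (HT hp) :=
  ringHom_ext_mono hp fun c n => by rw [galHTHom_mono, one_smul, twist_one, one_zpow, mul_one, RingHom.id_apply]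

/-- `galHTHom (σ τ) = galHTHom σ ∘ galHTHom τ`. [folklore] -/
theorem galHTHom_mul (σ τ : absoluteGaloisGroup F) :
    galHTHom hp (σ * τ) = (galHTHom hp σ).comp (galHTHom hp τ) :=
  ringHom_ext_mono hp fun c n => by
    have h1 : σ • (twist hp τ ^ n) = twist hp τ ^ n := by
      change MulSemiringAction.toRingHom _ (CompletedAlgClosure F) σ (twist hp τ ^ n) = _
      rw [map_zpow₀]
      change (σ • twist hp τ) ^ n = _
      rw [smul_twist]
    rw [RingHom.comp_apply, galHTHom_mono, galHTHom_mono, galHTHom_mono, mul_smul, smul_mul', h1,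
      twist_mul, mul_zpow, mul_assoc, mul_comm (twist hp τ ^ n), ← mul_assoc]

/-- **The action of `Γ_F` on `B_HT` by ring automorphisms** (`galHTHom σ` with inverse
`galHTHom σ⁻¹`). [cite: FontaineAsterisque223III, Exp. II §1.5.5] -/
def galHT : absoluteGaloisGroup F →* (HT hp ≃+* HT hp) where
  toFun σ := RingEquiv.ofRingHom (galHTHom hp σ) (galHTHom hp σ⁻¹)
    (by rw [← galHTHom_mul, mul_inv_cancel, galHTHom_one])
    (by rw [← galHTHom_mul, inv_mul_cancel, galHTHom_one])
  map_one' := RingEquiv.ext fun x => by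
    change galHTHom hp 1 x = x; rw [galHTHom_one, RingHom.id_apply]
  map_mul' σ τ := RingEquiv.ext fun x => by
    change galHTHom hp (σ * τ) x = galHTHom hp σ (galHTHom hp τ x); rw [galHTHom_mul, RingHom.comp_apply]

/-- `Γ_F` acts on `B_HT` by ring automorphisms. [cite: FontaineAsterisque223III, Exp. II §1.5.5] -/
instance instMulSemiringAction : MulSemiringAction (absoluteGaloisGroup F) (HT hp) :=
  MulSemiringAction.compHom _ (galHT hp)

/-- Unfolding: `σ • f = galHTHom σ f`. [folklore] -/
theorem smul_def (σ : absoluteGaloisGroup F) (f : HT hp) : σ • f = galHTHom hp σ f := rfl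

/-- **`σ • (c Tⁿ) = σ(c) χ(σ)ⁿ Tⁿ`.** [cite: FontaineAsterisque223III, Exp. II §1.5.5] -/
theorem smul_mono (σ : absoluteGaloisGroup F) (c : CompletedAlgClosure F) (n : ℤ) :
    σ • mono hp c n = mono hp (σ • c * twist hp σ ^ n) n := by
  rw [smul_def, galHTHom_mono]

/-- **The coefficient formula** `(σ • f)_n = σ(f_n) χ(σ)ⁿ`. [cite: FontaineOuyang2022, §5.1] -/
theorem coeff_smul (σ : absoluteGaloisGroup F) (f : HT hp) (n : ℤ) :
    coeff hp (σ • f) n = σ • coeff hp f n * twist hp σ ^ n := by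
  induction f using induction_on hp with
  | zero => rw [smul_zero, coeff_zero, smul_zero, zero_mul]
  | add f g hf hg => rw [smul_add, coeff_add, coeff_add, hf, hg, smul_add, add_mul]
  | mono' c m =>
    rw [smul_mono, coeff_mono, coeff_mono]
    split_ifs with h
    · subst h; rfl
    · rw [smul_zero, zero_mul]

/-- `(σ • f)_n = 0 ↔ f_n = 0`. [folklore] -/
theorem coeff_smul_eq_zero_iff (σ : absoluteGaloisGroup F) (f : HT hp) (n : ℤ) :
    coeff hp (σ • f) n = 0 ↔ coeff hp f n = 0 := by
  rw [coeff_smul, mul_eq_zero, or_iff_left (zpow_ne_zero n (twist_ne_zero hp σ)), smul_eq_zero_iff_eq]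

/-- The support is `Γ_F`-invariant. [folklore] -/
theorem support_smul (σ : absoluteGaloisGroup F) (f : HT hp) : support hp (σ • f) = support hp f := by
  ext n; rw [mem_support_iff, mem_support_iff, Ne, coeff_smul_eq_zero_iff]

/-- `σ` fixes `algebraMap F B_HT a`. [folklore] -/
theorem smul_algebraMap (σ : absoluteGaloisGroup F) (a : F) :
    σ • algebraMap F (HT hp) a = algebraMap F (HT hp) a := by
  rw [algebraMap_eq, smul_mono, zpow_zero, mul_one, CompletedAlgClosure.smul_algebraMap]

/-- The action is `F`-linear. [folklore] -/
instance instSMulCommClass : SMulCommClass (absoluteGaloisGroup F) F (HT hp) where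
  smul_comm σ a f := by
    rw [Algebra.smul_def, Algebra.smul_def, smul_mul', smul_algebraMap]

/-- Each `Fil^i` is `Γ_F`-stable. [folklore] -/
theorem smul_mem_fil (σ : absoluteGaloisGroup F) {i : ℤ} {f : HT hp} (hf : f ∈ fil hp i) :
    σ • f ∈ fil hp i := fun n hn => (coeff_smul_eq_zero_iff hp σ f n).mpr (hf n hn)

end HT

end Literature.NumberTheory.PAdicHodge

end
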